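import Mathlib
import Summits.ResolutionOfSingularities.ResolutionOfSingularities.Theorems.FrobeniusLadderFRationalResolutionCompletedBaseChangeFibrePoints

/-!
# Crux `FrobeniusLadder.FRationalResolution` (stmt-ResolutionOfSingularities-15317), line `redirect`,
# stub `stub_diagonalizableQuotientResolution` — two bricks for the two-step ÉTALE descent (ε) of MEMO-15317-leafhand2-g23 §3:
# the stalk of `Bl_I(Spec R)` at a GIVEN chart point, and the `Bl_𝔪`-transfer through the completion for any G-ring

`…CompletedBaseChangeFibrePoints.exists_chart_prime_ringEquiv_stalk` produces, for a point `p` of `Bl_I(Spec R)`, SOME chart and a prime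
with `𝒪_{Bl,p} ≅ R[I/x_i]_𝔔`; the descent (ε) (data read on `Bl_𝔪(Spec 𝒪_{Y,y})` and pushed to an affine étale chart) goes the
other way — from a prime `𝔔` of a chosen chart ring `R[I/x_i]` to the point `awayι(q)` — and needs the stalk there:
* ★ `nonempty_ringEquiv_stalk_awayι` — for `q ∈ Spec (R[It])_{(x_i t)}` and the prime `𝔔` of `R[I/x_i]` corresponding to `q` under
  `reesChartEquiv`: **`𝒪_{Bl_I(Spec R), awayι q} ≅ R[I/x_i]_𝔔`** (open immersion `awayι`, stalk of `Spec` = localization, transport along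
  `reesChartEquiv`);
* ★ `isRegular_affineBlowup_maximalIdeal_of_isGRing_of_ringEquiv_adicCompletion` — `B` ANY G-ring (e.g. a localization of an algebra of
  finite type over a field, tree `Matsumura1987_32_localization_holds`), `𝔮` a prime with `Bl_𝔪(Spec B_𝔮)` regular, `(B_𝔮)^ ≅ 𝒪̂` ⇒
  `Bl_𝔪(Spec 𝒪)` regular (the f.t.-over-a-field hypothesis of `…Points.…_local` was used only to get the G-ring property).

Honest label: plumbing toward ONE leaf stub (no stub, crux or summit closed). No definitions, no named facts, no sorry.
[cite: StacksProject, Tag 0804; Tag 01I0] [cite: Matsumura1987, Thm. 8.14; Thm. 23.7; §32] [cite: GortzWedhorn2020, Prop. 13.91 (2); (13.19) p. 415]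
-/

noncomputable section

-- single-problem summit: the doubled namespace component is forced
set_option linter.dupNamespace false

open IsLocalRing AlgebraicGeometry CategoryTheory
open Literature.AlgebraicGeometry.Resolution

namespace Summit.ResolutionOfSingularities.ResolutionOfSingularities.Theorems.FRationalResolution.CompletedBaseChangeFibreStalks

/-- ★ **The stalk of `Bl_I(Spec R)` at a given chart point**: for `x_i ∈ I`, a point `q` of the chart `Spec (R[It])_{(x_i t)}` and the
prime `𝔔` of the affine blowup algebra `R[I/x_i]` corresponding to `q` under `reesChartEquiv`, the local ring of `Bl_I(Spec R)` at
`awayι q` is isomorphic to `R[I/x_i]_𝔔`. [cite: StacksProject, Tag 0804; Tag 01I0] [cite: GortzWedhorn2020, (13.19) p. 415] -/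
theorem nonempty_ringEquiv_stalk_awayι {R : Type} [CommRing R] (I : Ideal R) (x : R) (hx : x ∈ I)
    (q : Spec (.of (HomogeneousLocalization.Away (reesGrading I) (reesT x hx))))
    (𝔔 : Ideal (blowupAlgebra I x)) [𝔔.IsPrime] (hmemq : ∀ s, s ∈ q.asIdeal ↔ reesChartEquiv (I := I) x hx s ∈ 𝔔) :
    Nonempty ((affineBlowup I).presheaf.stalk (Proj.awayι (reesGrading I) (reesT x hx) (reesT_mem x hx) one_pos q) ≃+*
      Localization.AtPrime 𝔔) := by
  -- stalk at `awayι q` ≅ stalk of the chart at `q` (open immersion)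
  let e₁ : (affineBlowup I).presheaf.stalk (Proj.awayι (reesGrading I) (reesT x hx) (reesT_mem x hx) one_pos q) ≃+*
      (Spec (.of (HomogeneousLocalization.Away (reesGrading I) (reesT x hx)))).presheaf.stalk q :=
    (asIso ((Proj.awayι (reesGrading I) (reesT x hx) (reesT_mem x hx) one_pos).stalkMap q)).commRingCatIsoToRingEquiv
  -- stalk of `Spec` at `q` ≅ localization
  letI : Algebra (HomogeneousLocalization.Away (reesGrading I) (reesT x hx))
      ((Spec (.of (HomogeneousLocalization.Away (reesGrading I) (reesT x hx)))).presheaf.stalk q) :=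
    (StructureSheaf.toStalk _ q).hom.toAlgebra
  have hloc : IsLocalization.AtPrime
      ((Spec (.of (HomogeneousLocalization.Away (reesGrading I) (reesT x hx)))).presheaf.stalk q) q.asIdeal :=
    StructureSheaf.IsLocalization.to_stalk _ q
  let e₂ := (IsLocalization.algEquiv q.asIdeal.primeCompl
    ((Spec (.of (HomogeneousLocalization.Away (reesGrading I) (reesT x hx)))).presheaf.stalk q)
    (Localization.AtPrime q.asIdeal)).toRingEquiv
  -- localizations at `q` and `𝔔` along `reesChartEquiv`
  obtain ⟨e₃⟩ := CompletedBaseChangeFibrePoints.nonempty_ringEquiv_localization_of_ringEquiv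
    (reesChartEquiv (I := I) x hx) q.asIdeal 𝔔 hmemq
  exact ⟨(e₁.trans e₂).trans e₃⟩

/-- ★ **`Bl_𝔪`-regularity through the completion, for any G-ring**: `B` a G-ring, `𝔮` a prime with `Bl_𝔪(Spec B_𝔮)` regular, `𝒪`
Noetherian local with `(B_𝔮)^ ≅ 𝒪̂` ⇒ `Bl_𝔪(Spec 𝒪)` regular. [cite: Matsumura1987, Thm. 8.14; Thm. 23.7; §32]
[cite: GortzWedhorn2020, Prop. 13.91 (2)] -/
theorem isRegular_affineBlowup_maximalIdeal_of_isGRing_of_ringEquiv_adicCompletion {B : Type} [CommRing B] (hB : IsGRing B)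
    (𝔮 : Ideal B) [𝔮.IsPrime] (hreg : Scheme.IsRegular (affineBlowup (maximalIdeal (Localization.AtPrime 𝔮))))
    {𝒪 : Type} [CommRing 𝒪] [IsNoetherianRing 𝒪] [IsLocalRing 𝒪]
    (e : AdicCompletion (maximalIdeal (Localization.AtPrime 𝔮)) (Localization.AtPrime 𝔮) ≃+* AdicCompletion (maximalIdeal 𝒪) 𝒪) :
    Scheme.IsRegular (affineBlowup (maximalIdeal 𝒪)) := by
  haveI : IsNoetherianRing B := hB.1
  haveI : IsNoetherianRing (Localization.AtPrime 𝔮) :=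
    IsLocalization.isNoetherianRing 𝔮.primeCompl (Localization.AtPrime 𝔮) inferInstance
  have hreg' : Scheme.IsRegular (affineBlowup (𝔮.map (algebraMap B (Localization.AtPrime 𝔮)))) := by
    rwa [Localization.AtPrime.map_eq_maximalIdeal]
  have h1 := BlowupRegularCompletionAscent.isRegular_affineBlowup_adicCompletion_of_isGRing hB 𝔮 𝔮 hreg'
  rw [Localization.AtPrime.map_eq_maximalIdeal, ← AdicCompletion.maximalIdeal_eq_map] at h1
  have h2 := BlowupOrbitCentre.isRegular_affineBlowup_map_of_ringEquiv e _ h1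
  rw [PointBlowupOfCompletion.map_maximalIdeal_ringEquiv e, AdicCompletion.maximalIdeal_eq_map] at h2
  exact BlowupRegularFlatChart.isRegular_affineBlowup_of_adicCompletion (maximalIdeal 𝒪) h2

/-- The same for a LOCALIZATION `B` of an algebra `B₀` of finite type over a field (e.g. `B = B₀ ⊗_C C_𝔮`, a chart ring of
`Bl_{IC_𝔮}(Spec C_𝔮)`): `B` is a G-ring by `Matsumura1987_32_6_cor_holds` + `Matsumura1987_32_localization_holds`.
[cite: Matsumura1987, §32, Cor. of Thm. 32.6] -/
theorem isRegular_affineBlowup_maximalIdeal_of_isLocalization_of_ringEquiv_adicCompletion (K : Type) [Field K] {B₀ : Type}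
    [CommRing B₀] [Algebra K B₀] [Algebra.FiniteType K B₀] (M : Submonoid B₀) {B : Type} [CommRing B] [Algebra B₀ B]
    [IsLocalization M B] (𝔮 : Ideal B) [𝔮.IsPrime]
    (hreg : Scheme.IsRegular (affineBlowup (maximalIdeal (Localization.AtPrime 𝔮))))
    {𝒪 : Type} [CommRing 𝒪] [IsNoetherianRing 𝒪] [IsLocalRing 𝒪]
    (e : AdicCompletion (maximalIdeal (Localization.AtPrime 𝔮)) (Localization.AtPrime 𝔮) ≃+* AdicCompletion (maximalIdeal 𝒪) 𝒪) :
    Scheme.IsRegular (affineBlowup (maximalIdeal 𝒪)) :=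
  isRegular_affineBlowup_maximalIdeal_of_isGRing_of_ringEquiv_adicCompletion
    (Matsumura1987_32_localization_holds.{0} B₀ B M inferInstance (Matsumura1987_32_6_cor_holds.{0} K B₀ ‹_›)) 𝔮 hreg e

end Summit.ResolutionOfSingularities.ResolutionOfSingularities.Theorems.FRationalResolution.CompletedBaseChangeFibreStalks

end
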